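import Summits.AtomisticToContinuum.BoseEinsteinCondensation.Theses.BECIntegerBlockRotor
import HarnessLib

/-!
# `FamilyToPeriodic` (stmt-AtomisticToContinuum-13598, route `BECIntegerBlockRotor`, support,
# rank 9) PROVED  (decomp-a2c · hand-1 g9)

`FamilyToPeriodic : FamilyBEC → FillingContinuity → (∀ v repulsive finite-range, PeriodicBEC(v))`:
BEC along the integer-filled family plus quasi-monotonicity of the ground-state condensate in the
particle number give BEC of periodic near-minimisers at every small density, eventually in `N`
(the exact antecedent of `BoundaryTransferWeak`).  Pure real arithmetic + `ℝ≥0∞` bookkeeping, as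
audited by refuter g41-27 / g44-10 (2026-08-15; the candidate file `FTP.lean` of g44-10 is not
readable from hand jails, so the proof is re-done from the recorded constants):

* density cap `ρ < ρ₀ := min ρ₀ᶠ (min ρ₁ (min ((A³/2)²) ((cA³/(2(c+C)))²)))`;
* box `L := sideLength ρ N` (`L³ = N/ρ`), `X := L√ρ/A` with `X ≥ 36/5` for `N ≥ 374A³/√ρ`;
* even block number `K := 2⌈5X/18⌉` (`5X/9 ≤ K ≤ 5X/6`), so `K³ ≤ (125/216)·N√ρ/A³ ≤ (125/432)N`
  and `(c + C)K³ ≤ cN/2`;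
* integer-filled particle number `N' := K³⌊N/K³⌋` (`K³ ∣ N'`, `N − N' < K³`, `N' ≥ (307/432)N`), whose
  density `N'/L³ ∈ [(25/36)ρ, ρ]` keeps `L/K` inside the window `[A/√(N'/L³), 2A/√(N'/L³)]`;
* `FamilyBEC` at `(N', L)` and `FillingContinuity` from `N'` to `N` give
  `periodicCondensateNumber v N L ≥ cN' − C(N − N') ≥ cN/2 > cN/4`, and `lt_iSup_iff` (twice) +
  `iInf₂_le` unpack the supremum over `δ` into one `δ > 0` serving every `δ`-near-minimiser.

Main theorem: `familyToPeriodic_proof : Theses.BECIntegerBlockRotor.FamilyToPeriodic` (`c' = c/4`).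
No definitions, no `sorry`.
-/

noncomputable section

open Filter
open scoped ENNReal

namespace Summit.AtomisticToContinuum.BoseEinsteinCondensation.Theorems.BECIntegerBlockRotorFamilyToPeriodic

open Literature.MathematicalPhysics.QuantumManyBody.BoseGas
open Literature.Barriers.AtomisticToContinuum.BoseGas

/-- `L = (N/ρ)^{1/3}` has `L³ = N/ρ`. [folklore] -/
theorem sideLength_cube {ρ : ℝ} (hρ : 0 < ρ) (N : ℕ) : sideLength ρ N ^ 3 = (N : ℝ) / ρ := by
  have h : (0 : ℝ) ≤ N / ρ := div_nonneg N.cast_nonneg hρ.le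
  rw [sideLength, ← Real.rpow_natCast, ← Real.rpow_mul h]
  norm_num

/-- Unpacking `periodicCondensateNumber`: a STRICT lower bound `m < sup_δ inf_Ψ ⟨Ψ, n₀ Ψ⟩` yields one
`δ > 0` at which every `δ`-near-minimiser has condensate occupation `≥ m`. [folklore] -/
theorem exists_delta_of_lt_periodicCondensateNumber {v : ℝ → ℝ≥0∞} {N : ℕ} {L : ℝ} {m : ℝ≥0∞}
    (h : m < periodicCondensateNumber v N L) :
    ∃ δ : ℝ≥0∞, 0 < δ ∧ ∀ Ψ : PeriodicTrialState N L,
      periodicEnergy v Ψ ≤ periodicGroundStateEnergy v N L + δ → m ≤ condensateOccupation N L Ψ.ψ := by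
  rw [periodicCondensateNumber] at h
  obtain ⟨δ, hδ'⟩ := lt_iSup_iff.1 h
  obtain ⟨hδ, hlt⟩ := lt_iSup_iff.1 hδ'
  exact ⟨δ, hδ, fun Ψ hΨ => (hlt.trans_le (iInf₂_le Ψ hΨ)).le⟩

set_option maxHeartbeats 400000 in
/-- **`FamilyToPeriodic` (item stmt-AtomisticToContinuum-13598) PROVED.**  `FamilyBEC` and
`FillingContinuity` imply, for every repulsive finite-range `v`, BEC of the periodic
near-minimisers at every density `ρ < ρ₀`, eventually in `N`, with constant `c/4`.
[cite: LSSY2005, Thm. 5.1 (5.15)–(5.16)] -/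
theorem familyToPeriodic_proof : Theses.BECIntegerBlockRotor.FamilyToPeriodic := by
  intro hF hFC v hv
  obtain ⟨A, hA, ρF, hρF, c, hc, N₀, HF⟩ := hF v hv
  obtain ⟨C, hC, ρ₁, hρ₁, HFC⟩ := hFC v hv
  -- the two smallness radii for `√ρ`
  obtain ⟨r₁, hr₁_def⟩ : ∃ r₁ : ℝ, r₁ = A ^ 3 / 2 := ⟨_, rfl⟩
  obtain ⟨r₂, hr₂_def⟩ : ∃ r₂ : ℝ, r₂ = c * A ^ 3 / (2 * (c + C)) := ⟨_, rfl⟩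
  have hr₁ : 0 < r₁ := by rw [hr₁_def]; positivity
  have hcC : 0 < c + C := by linarith
  have hr₂ : 0 < r₂ := by rw [hr₂_def]; positivity
  refine ⟨min ρF (min ρ₁ (min (r₁ ^ 2) (r₂ ^ 2))),
    lt_min hρF (lt_min hρ₁ (lt_min (by positivity) (by positivity))), fun ρ hρ hρlt => ?_⟩
  have hρF' : ρ < ρF := lt_of_lt_of_le hρlt (min_le_left _ _)
  have hρ₁' : ρ < ρ₁ := lt_of_lt_of_le hρlt ((min_le_right _ _).trans (min_le_left _ _))
  have hρr₁ : ρ < r₁ ^ 2 :=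
    lt_of_lt_of_le hρlt ((min_le_right _ _).trans ((min_le_right _ _).trans (min_le_left _ _)))
  have hρr₂ : ρ < r₂ ^ 2 :=
    lt_of_lt_of_le hρlt ((min_le_right _ _).trans ((min_le_right _ _).trans (min_le_right _ _)))
  set sr : ℝ := Real.sqrt ρ with hsr_def
  have hsr : 0 < sr := Real.sqrt_pos.2 hρ
  have hsr2 : sr ^ 2 = ρ := Real.sq_sqrt hρ.le
  have hsr₁ : sr ≤ r₁ := by
    rw [hsr_def, ← Real.sqrt_sq hr₁.le]; exact Real.sqrt_le_sqrt hρr₁.le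
  have hsr₂ : sr ≤ r₂ := by
    rw [hsr_def, ← Real.sqrt_sq hr₂.le]; exact Real.sqrt_le_sqrt hρr₂.le
  refine ⟨c / 4, by positivity, ?_⟩
  filter_upwards [tendsto_natCast_atTop_atTop.eventually_ge_atTop (374 * A ^ 3 / sr),
    eventually_ge_atTop (2 * N₀), eventually_ge_atTop 1] with N hNX hN2 hN1
  -- the box
  set L : ℝ := sideLength ρ N with hL_def
  have hNr : (1 : ℝ) ≤ N := by exact_mod_cast hN1
  have hL3 : L ^ 3 = (N : ℝ) / ρ := sideLength_cube hρ N
  have hL : 0 < L := by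
    rw [hL_def, sideLength]; exact Real.rpow_pos_of_pos (by positivity) _
  have hNρ : (N : ℝ) = ρ * L ^ 3 := by rw [hL3]; field_simp
  -- the parameter `X = L√ρ/A ≥ 36/5`
  obtain ⟨X, hX_def⟩ : ∃ X : ℝ, X = L * sr / A := ⟨_, rfl⟩
  have hX0 : 0 < X := by rw [hX_def]; positivity
  have hAX : A * X = L * sr := by rw [hX_def]; field_simp
  have hX3 : X ^ 3 = (N : ℝ) * sr / A ^ 3 := by
    have hsr3 : sr ^ 3 = ρ * sr := by rw [pow_succ, hsr2]
    rw [hX_def, div_pow, mul_pow, hL3, hsr3]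
    field_simp
  have hX72 : 36 / 5 ≤ X := by
    have h1 : 374 * A ^ 3 ≤ (N : ℝ) * sr := by rwa [div_le_iff₀ hsr] at hNX
    have h2 : (374 : ℝ) ≤ X ^ 3 := by
      rw [hX3, le_div_iff₀ (by positivity)]; linarith
    by_contra h3
    push Not at h3
    have h4 : X ^ 3 < (36 / 5 : ℝ) ^ 3 := pow_lt_pow_left₀ h3 hX0.le three_ne_zero
    norm_num at h4
    linarith
  -- the even block number `K = 2⌈5X/18⌉`
  obtain ⟨m, hm_def⟩ : ∃ m : ℕ, m = ⌈5 * X / 18⌉₊ := ⟨_, rfl⟩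
  have hm1 : 5 * X / 18 ≤ (m : ℝ) := by rw [hm_def]; exact Nat.le_ceil _
  have hm2 : (m : ℝ) < 5 * X / 18 + 1 := by rw [hm_def]; exact Nat.ceil_lt_add_one (by positivity)
  have hmpos : 0 < m := by rw [hm_def]; exact Nat.ceil_pos.2 (by positivity)
  obtain ⟨K, hK_def⟩ : ∃ K : ℕ, K = 2 * m := ⟨_, rfl⟩
  have hKpos : 0 < K := by rw [hK_def]; omega
  have hKeven : Even K := ⟨m, by rw [hK_def]; ring⟩
  have hKr : (K : ℝ) = 2 * m := by rw [hK_def]; push_cast; ring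
  have hKrpos : (0 : ℝ) < K := by exact_mod_cast hKpos
  have hK1 : 5 * X / 9 ≤ (K : ℝ) := by rw [hKr]; linarith
  have hK2 : (K : ℝ) ≤ 5 * X / 6 := by rw [hKr]; linarith
  -- `K³` is a small fraction of `N`
  have hK3pos : 0 < K ^ 3 := pow_pos hKpos 3
  have hK3r : ((K ^ 3 : ℕ) : ℝ) ≤ 125 / 216 * ((N : ℝ) * sr / A ^ 3) := by
    push_cast
    rw [← hX3]
    have h1 : (K : ℝ) ^ 3 ≤ (5 * X / 6) ^ 3 := pow_le_pow_left₀ hKrpos.le hK2 3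
    have h2 : (5 * X / 6) ^ 3 = 125 / 216 * X ^ 3 := by ring
    linarith
  have hNsrA : (N : ℝ) * sr / A ^ 3 ≤ (N : ℝ) / 2 := by
    rw [div_le_iff₀ (by positivity)]
    have h1 : (N : ℝ) * sr ≤ (N : ℝ) * r₁ := mul_le_mul_of_nonneg_left hsr₁ (by positivity)
    rw [hr₁_def] at h1
    linarith
  have hK3N : ((K ^ 3 : ℕ) : ℝ) ≤ 125 / 432 * (N : ℝ) := by linarith
  have hK3c : (c + C) * ((K ^ 3 : ℕ) : ℝ) ≤ c / 2 * (N : ℝ) := by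
    have h1 : (c + C) * ((N : ℝ) * sr / A ^ 3) ≤ c / 2 * (N : ℝ) := by
      have h2 : (c + C) * sr ≤ (c + C) * r₂ := mul_le_mul_of_nonneg_left hsr₂ hcC.le
      have h3 : (c + C) * r₂ = c * A ^ 3 / 2 := by
        rw [hr₂_def]; field_simp
      have h4 : (c + C) * ((N : ℝ) * sr / A ^ 3) = ((c + C) * sr) * (N : ℝ) / A ^ 3 := by ring
      rw [h4, div_le_iff₀ (by positivity)]
      have h5 : (c + C) * sr * (N : ℝ) ≤ (c * A ^ 3 / 2) * (N : ℝ) :=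
        mul_le_mul_of_nonneg_right (h2.trans h3.le) (by positivity)
      linarith [h5]
    have h6 : (c + C) * ((K ^ 3 : ℕ) : ℝ) ≤ (c + C) * (125 / 216 * ((N : ℝ) * sr / A ^ 3)) :=
      mul_le_mul_of_nonneg_left hK3r hcC.le
    have h7 : 0 ≤ (c + C) * ((N : ℝ) * sr / A ^ 3) := by positivity
    linarith [h1, h6, h7]
  -- the integer-filled particle number `N' = K³⌊N/K³⌋`
  obtain ⟨N', hN'_def⟩ : ∃ N' : ℕ, N' = K ^ 3 * (N / K ^ 3) := ⟨_, rfl⟩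
  have hN'le : N' ≤ N := by rw [hN'_def]; exact Nat.mul_div_le N (K ^ 3)
  have hdvd : K ^ 3 ∣ N' := by rw [hN'_def]; exact Dvd.intro _ rfl
  have hN'ler : (N' : ℝ) ≤ N := by exact_mod_cast hN'le
  have hsub : (N : ℝ) - N' < ((K ^ 3 : ℕ) : ℝ) := by
    have h1 : K ^ 3 * (N / K ^ 3) + N % K ^ 3 = N := Nat.div_add_mod N (K ^ 3)
    have h2 : N % K ^ 3 < K ^ 3 := Nat.mod_lt N hK3pos
    have h3 : (N : ℝ) = (N' : ℝ) + ((N % K ^ 3 : ℕ) : ℝ) := by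
      rw [hN'_def]; exact_mod_cast h1.symm
    have h4 : ((N % K ^ 3 : ℕ) : ℝ) < ((K ^ 3 : ℕ) : ℝ) := by exact_mod_cast h2
    linarith
  have hN'ge : 307 / 432 * (N : ℝ) ≤ N' := by linarith
  -- hypotheses of `FamilyBEC` at `(N', L)`
  have hN0' : N₀ ≤ N' := by
    have h1 : ((2 * N₀ : ℕ) : ℝ) ≤ N := by exact_mod_cast hN2
    push_cast at h1
    have h2 : (N₀ : ℝ) ≤ N' := by linarith
    exact_mod_cast h2
  have hN'cap : (N' : ℝ) ≤ ρF * L ^ 3 := by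
    calc (N' : ℝ) ≤ N := hN'ler
      _ = ρ * L ^ 3 := hNρ
      _ ≤ ρF * L ^ 3 := mul_le_mul_of_nonneg_right hρF'.le (by positivity)
  have hNcap₁ : (N : ℝ) ≤ ρ₁ * L ^ 3 := by
    rw [hNρ]; exact mul_le_mul_of_nonneg_right hρ₁'.le (by positivity)
  -- the density of `N'` and the window
  have hρ' : (N' : ℝ) / L ^ 3 = ρ * ((N' : ℝ) / N) := by
    rw [hNρ]; field_simp
  have hρ'le : (N' : ℝ) / L ^ 3 ≤ ρ := by
    rw [hρ']
    have : (N' : ℝ) / N ≤ 1 := (div_le_one (by positivity)).2 hN'ler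
    exact (mul_le_mul_of_nonneg_left this hρ.le).trans_eq (mul_one ρ)
  have hρ'ge : 25 / 36 * ρ ≤ (N' : ℝ) / L ^ 3 := by
    rw [hρ']
    have : 307 / 432 ≤ (N' : ℝ) / N := by rw [le_div_iff₀ (by positivity)]; linarith
    have h := mul_le_mul_of_nonneg_left this hρ.le
    linarith
  have hρ'pos : 0 < (N' : ℝ) / L ^ 3 := lt_of_lt_of_le (by positivity) hρ'ge
  have hs'pos : 0 < Real.sqrt ((N' : ℝ) / L ^ 3) := Real.sqrt_pos.2 hρ'pos
  have hs'le : Real.sqrt ((N' : ℝ) / L ^ 3) ≤ sr := Real.sqrt_le_sqrt hρ'le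
  have hs'ge : 5 / 6 * sr ≤ Real.sqrt ((N' : ℝ) / L ^ 3) := by
    have h1 : Real.sqrt (25 / 36 * ρ) ≤ Real.sqrt ((N' : ℝ) / L ^ 3) := Real.sqrt_le_sqrt hρ'ge
    have h2 : Real.sqrt (25 / 36 * ρ) = 5 / 6 * sr := by
      rw [Real.sqrt_mul (by norm_num), hsr_def,
        show (25 / 36 : ℝ) = (5 / 6) ^ 2 by norm_num, Real.sqrt_sq (by norm_num)]
    linarith
  have hw1 : A / Real.sqrt ((N' : ℝ) / L ^ 3) ≤ L / (K : ℝ) := by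
    rw [div_le_div_iff₀ hs'pos hKrpos]
    have h1 : A * (K : ℝ) ≤ A * (5 * X / 6) := mul_le_mul_of_nonneg_left hK2 hA.le
    have h2 : A * (5 * X / 6) = 5 / 6 * (L * sr) := by rw [← hAX]; ring
    have h3 : L * (5 / 6 * sr) ≤ L * Real.sqrt ((N' : ℝ) / L ^ 3) :=
      mul_le_mul_of_nonneg_left hs'ge hL.le
    linarith
  have hw2 : L / (K : ℝ) ≤ 2 * A / Real.sqrt ((N' : ℝ) / L ^ 3) := by
    rw [div_le_div_iff₀ hKrpos hs'pos]
    have h1 : L * Real.sqrt ((N' : ℝ) / L ^ 3) ≤ L * sr := mul_le_mul_of_nonneg_left hs'le hL.le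
    have h2 : A * (5 * X / 9) ≤ A * (K : ℝ) := mul_le_mul_of_nonneg_left hK1 hA.le
    have h3 : 0 ≤ A * (K : ℝ) := by positivity
    have h4 : L * sr = 9 / 5 * (A * (5 * X / 9)) := by rw [← hAX]; ring
    linarith
  -- `FamilyBEC` at `(N', L)` and `FillingContinuity` from `N'` to `N`
  have hFam : ENNReal.ofReal (c * N') ≤ periodicCondensateNumber v N' L :=
    HF N' L hL hN0' hN'cap ⟨K, hKeven, hKpos, hdvd, hw1, hw2⟩
  have hFill : periodicCondensateNumber v N' L ≤
      periodicCondensateNumber v N L + ENNReal.ofReal (C * ((N : ℝ) - (N' : ℝ))) :=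
    HFC N' N L hL hN'le hNcap₁
  -- the real bookkeeping `cN' − C(N − N') ≥ cN/2`
  have hkey : c / 2 * (N : ℝ) ≤ c * N' - C * ((N : ℝ) - N') := by
    have e1 : c * ((N : ℝ) - ((K ^ 3 : ℕ) : ℝ)) ≤ c * N' :=
      mul_le_mul_of_nonneg_left (by linarith) hc.le
    have e2 : C * ((N : ℝ) - N') ≤ C * ((K ^ 3 : ℕ) : ℝ) := mul_le_mul_of_nonneg_left hsub.le hC
    have e3 : c * ((N : ℝ) - ((K ^ 3 : ℕ) : ℝ)) = c * N - c * ((K ^ 3 : ℕ) : ℝ) := by ring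
    have e4 : (c + C) * ((K ^ 3 : ℕ) : ℝ) = c * ((K ^ 3 : ℕ) : ℝ) + C * ((K ^ 3 : ℕ) : ℝ) := by ring
    linarith [e1, e2, e3, e4, hK3c]
  have hP : ENNReal.ofReal (c / 2 * (N : ℝ)) ≤ periodicCondensateNumber v N L := by
    have h1 : ENNReal.ofReal (c * N') - ENNReal.ofReal (C * ((N : ℝ) - (N' : ℝ))) ≤
        periodicCondensateNumber v N L := tsub_le_iff_right.2 (hFam.trans hFill)
    refine le_trans ?_ h1
    rw [← ENNReal.ofReal_sub _ (mul_nonneg hC (sub_nonneg.2 hN'ler))]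
    exact ENNReal.ofReal_le_ofReal hkey
  have hlt : ENNReal.ofReal (c / 4 * (N : ℝ)) < periodicCondensateNumber v N L := by
    refine lt_of_lt_of_le ?_ hP
    rw [ENNReal.ofReal_lt_ofReal_iff (by positivity)]
    have : 0 < c * (N : ℝ) := by positivity
    linarith
  exact exists_delta_of_lt_periodicCondensateNumber hlt

end Summit.AtomisticToContinuum.BoseEinsteinCondensation.Theorems.BECIntegerBlockRotorFamilyToPeriodic

end
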